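import Mathlib
import HarnessLib
import Summits.ValiantsHypothesis.ValiantsHypothesis.Theorems.LacunarySymmetroidMatrixDescartesReshapingGenericDecay

/-!
# K1 + K1′ (val-idea-23 g2) — part 2/4: strongly log-concave sequences and the reshaping minor (K1 signed)

Sections C–D of the original file (verbatim): `logRatio` and its gap lemmas, `incr_gap`, `det_logConcaveMinor_ne_zero`,
`reshapingGeneric_signed` (sign-blind K1: every base-`P` digit reshaping of a strongly `q`-log-concave `f`, `q ≥ 4`, has full rank).

AUTHORSHIP: val-idea-23 g2 (card `reshaping-generic`, crux workfile `Cruxes/MatrixDescartes/ReshapingGenericK1Proof.lean` rev 4,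
staged bytes sha12 527413dd06f8); SPLIT into four ≤ 400-line files and landed by val-lit-p7 g14 (landing hand, director R290 (2)(iii) /
desk RULING #329) with no mathematical change: parts `…ReshapingGenericDecay` (A–B), `…ReshapingGenericLogConcave` (C–D),
`…ReshapingGenericHankel` (D′), `…ReshapingGeneric` (K1 positive form, F Kronecker, E K1Check).  VP ≠ VNP is not touched.
-/

set_option linter.dupNamespace false
set_option autoImplicit false

namespace Summit.ValiantsHypothesis.ValiantsHypothesis.Theorems.LacunarySymmetroidMatrixDescartes.ReshapingGeneric

open Finset Real Matrix

/-! ## C. Strongly log-concave sequences: log-ratios drop by `log q` per step -/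

section LogConcave

variable {q : ℝ} {f : ℕ → ℝ}

/-- Strong `q`-log-concavity: consecutive log-ratios drop by at least `log q`. [folklore] -/
lemma logRatio_succ_le (hq : 0 < q) (hne : ∀ k, f k ≠ 0)
    (hlc : ∀ k, q * (|f k| * |f (k + 2)|) ≤ f (k + 1) ^ 2) (k : ℕ) :
    (Real.log (f (k + 1 + 1)) - Real.log (f (k + 1))) + Real.log q ≤ (Real.log (f (k + 1)) - Real.log (f k)) := by
  have hk0 : 0 < |f k| := abs_pos.mpr (hne k)
  have hk2 : 0 < |f (k + 2)| := abs_pos.mpr (hne (k + 2))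
  have hfk : 0 < |f k| * |f (k + 2)| := mul_pos hk0 hk2
  have h := Real.log_le_log (mul_pos hq hfk) (hlc k)
  rw [Real.log_mul hq.ne' hfk.ne', Real.log_mul hk0.ne' hk2.ne', Real.log_abs, Real.log_abs, Real.log_pow] at h
  push_cast at h
  linarith

/-- Iterated form: log-ratios `t` steps apart differ by at least `t·log q`. [folklore] -/
lemma logRatio_add_le (hq : 0 < q) (hne : ∀ k, f k ≠ 0)
    (hlc : ∀ k, q * (|f k| * |f (k + 2)|) ≤ f (k + 1) ^ 2) (k t : ℕ) :
    (Real.log (f (k + t + 1)) - Real.log (f (k + t))) + t * Real.log q ≤ (Real.log (f (k + 1)) - Real.log (f k)) := by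
  induction t with
  | zero => simp
  | succ t ih =>
    have := logRatio_succ_le hq hne hlc (k + t)
    rw [show k + (t + 1) = k + t + 1 by ring]
    push_cast
    linarith

/-- Telescoping of `log f` along `t` steps as a sum of log-ratios. [folklore] -/
lemma log_telescope (f : ℕ → ℝ) (k t : ℕ) :
    Real.log (f (k + t)) - Real.log (f k) = ∑ s ∈ range t, (Real.log (f (k + s + 1)) - Real.log (f (k + s))) := by
  have h := Finset.sum_range_sub (fun s => Real.log (f (k + s))) t
  simp only [Nat.add_zero] at h
  rw [← h]
  apply Finset.sum_congr rfl; intro s _; rw [← add_assoc]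

/-- **Gap-Monge increments.**  With `W x i = log f (a x + b i)`, `a` increasing and `b` decreasing with steps `≥ 2`,
the row increments grow by at least `2 log q` per column step. -/
lemma incr_gap (hq : 1 ≤ q) (hne : ∀ k, f k ≠ 0)
    (hlc : ∀ k, q * (|f k| * |f (k + 2)|) ≤ f (k + 1) ^ 2) (a b : ℕ → ℕ) (j i : ℕ)
    (ha : a j < a (j + 1)) (hb : b (i + 1) + 2 ≤ b i) :
    (Real.log (f (a (j + 1) + b i)) - Real.log (f (a j + b i))) + 2 * Real.log q
      ≤ Real.log (f (a (j + 1) + b (i + 1))) - Real.log (f (a j + b (i + 1))) := by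
  have hq0 : 0 < q := by linarith
  have hlq : 0 ≤ Real.log q := Real.log_nonneg hq
  set n := a (j + 1) - a j with hn
  have hn1 : 1 ≤ n := by omega
  set g := b i - b (i + 1) with hg
  have hg2 : 2 ≤ g := by omega
  have e1 : a (j + 1) + b i = (a j + b i) + n := by omega
  have e2 : a (j + 1) + b (i + 1) = (a j + b (i + 1)) + n := by omega
  rw [e1, e2, log_telescope f (a j + b i) n, log_telescope f (a j + b (i + 1)) n]
  -- termwise comparison with gap `g log q ≥ 2 log q`
  have hterm : ∀ s ∈ range n, (Real.log (f (a j + b i + s + 1)) - Real.log (f (a j + b i + s))) + 2 * Real.log q ≤ (Real.log (f (a j + b (i + 1) + s + 1)) - Real.log (f (a j + b (i + 1) + s))) := by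
    intro s _
    have h := logRatio_add_le hq0 hne hlc (a j + b (i + 1) + s) g
    have e3 : a j + b (i + 1) + s + g = a j + b i + s := by omega
    rw [e3] at h
    have : (2 : ℝ) * Real.log q ≤ (g : ℝ) * Real.log q := by
      have : (2 : ℝ) ≤ (g : ℝ) := by exact_mod_cast hg2
      nlinarith
    linarith
  have hsum := Finset.sum_le_sum hterm
  rw [Finset.sum_add_distrib, Finset.sum_const, Finset.card_range, nsmul_eq_mul] at hsum
  have : (2 : ℝ) * Real.log q ≤ (n : ℝ) * (2 * Real.log q) := by
    have : (1 : ℝ) ≤ (n : ℝ) := by exact_mod_cast hn1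
    nlinarith
  linarith

/-! ## D. The theorem: every square «increasing rows / 2-spread decreasing columns» minor of `(f (a + b))`
is non-singular; hence every digit reshaping of a strongly log-concave sequence has full rank. -/

/-- **K1 core.**  For `q ≥ 4` and `f` strongly `q`-log-concave (`q·f(k)·f(k+2) ≤ f(k+1)²`, `f > 0`), the matrix
`(x, i) ↦ f (a x + b i)` with `a` strictly increasing and `b` strictly decreasing with steps `≥ 2` has non-zero
determinant. -/
theorem det_logConcaveMinor_ne_zero (hq : 4 ≤ q) (hne : ∀ k, f k ≠ 0)
    (hlc : ∀ k, q * (|f k| * |f (k + 2)|) ≤ f (k + 1) ^ 2) {r : ℕ} (a b : ℕ → ℕ)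
    (ha : ∀ j, j + 1 < r → a j < a (j + 1)) (hb : ∀ i, i + 1 < r → b (i + 1) + 2 ≤ b i) :
    (Matrix.of fun x i : Fin r => f (a x + b i)).det ≠ 0 := by
  have hq1 : (1 : ℝ) ≤ q := by linarith
  have hlq : Real.log 4 ≤ Real.log q := Real.log_le_log (by norm_num) hq
  have hlq0 : 0 ≤ Real.log q := Real.log_nonneg hq1
  set W : ℕ → ℕ → ℝ := fun x i => Real.log (f (a x + b i)) with hW
  have hgap : ∀ j i, j + 1 < r → i + 1 < r →
      W (j + 1) i - W j i + 2 * Real.log q ≤ W (j + 1) (i + 1) - W j (i + 1) := by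
    intro j i hj hi
    simpa [hW] using incr_gap hq1 hne hlc a b j i (ha j hj) (hb i hi)
  obtain ⟨u, v, hdiag, hoff⟩ := decay_of_gapMonge r W (Real.log q) hlq0 hgap
  -- the normalised matrix `N = diag(e^{-u}) · A · diag(e^{-v})`, `|N x i| = exp (W x i - u x - v i)`
  set A : Matrix (Fin r) (Fin r) ℝ := Matrix.of fun x i : Fin r => f (a x + b i) with hAdef
  set N : Matrix (Fin r) (Fin r) ℝ := Matrix.of fun x i : Fin r => Real.exp (-u x) *
      ((Matrix.of fun x i : Fin r => Real.exp (-v i) * A x i) x i) with hNdef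
  have hN : ∀ x i : Fin r, |N x i| = Real.exp (W x i - u x - v i) := by
    intro x i
    simp only [hNdef, hAdef, Matrix.of_apply, abs_mul, abs_of_pos (Real.exp_pos _)]
    rw [← Real.exp_log_eq_abs (hne _),
      show W x i - u x - v i = -u x + (-v i + Real.log (f (a x + b i))) by simp only [hW]; ring,
      Real.exp_add, Real.exp_add]
  have hA : N.det ≠ 0 := det_ne_zero_of_abs_decay N
    (fun x => by rw [hN, hdiag x x.isLt, Real.exp_zero])
    (by
      intro x i hxi
      rw [hN]
      apply Real.exp_le_exp.mpr
      have h := hoff x i x.isLt i.isLt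
      have : -(Real.log q) * (Nat.dist x i : ℝ) ≤ -(Real.log 4) * (Nat.dist x i : ℝ) := by
        have : (0 : ℝ) ≤ (Nat.dist x i : ℝ) := by positivity
        nlinarith
      exact h.trans this)
  rw [hNdef, Matrix.det_mul_column, Matrix.det_mul_row] at hA
  intro h0
  apply hA
  rw [h0]; ring

/-- **K1, signed form (full-rank reshapings; critic price P1 of VERDICT #12).**  Every base-`P` digit reshaping
`(x, y) ↦ f (P·y + x)` (`x < P`, `y < H`) of a nowhere-zero sequence with `q·|f(k)|·|f(k+2)| ≤ f(k+1)²`, `q ≥ 4` (signs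
ARBITRARY), has rank `min P H`. -/
theorem reshapingGeneric_signed : ∀ q : ℝ, 4 ≤ q → ∀ f : ℕ → ℝ,
    ((∀ k, f k ≠ 0) ∧ ∀ k, q * (|f k| * |f (k + 2)|) ≤ f (k + 1) ^ 2) →
    ∀ P H : ℕ, (Matrix.of fun (x : Fin P) (y : Fin H) => f (P * (y : ℕ) + (x : ℕ))).rank = min P H := by
  intro q hq f hf P H
  set M : Matrix (Fin P) (Fin H) ℝ := Matrix.of fun (x : Fin P) (y : Fin H) => f (P * (y : ℕ) + (x : ℕ)) with hM
  apply le_antisymm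
  · exact le_min (Matrix.rank_le_height M) (Matrix.rank_le_width M)
  · set r := min P H with hr
    have hrP : r ≤ P := min_le_left _ _
    have hrH : r ≤ H := min_le_right _ _
    rcases Nat.lt_or_ge P 2 with hP | hP
    · -- `P ≤ 1`: rank ≥ min P H is `0` or a non-zero `1 × H` row
      interval_cases P
      · simp [hr]
      · -- P = 1
        rcases Nat.eq_zero_or_pos H with hH | hH
        · subst hH; simp [hr]
        · have h1 : r = 1 := by rw [hr]; exact Nat.min_eq_left (by omega)
          rw [h1]
          -- the `1 × 1` minor at column 0 is `f 0... ` non-zero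
          let S : Matrix (Fin 1) (Fin 1) ℝ := M.submatrix (Fin.castLE (le_refl 1)) (Fin.castLE (by omega : 1 ≤ H))
          have hS : S.det ≠ 0 := by
            rw [Matrix.det_fin_one]
            simp only [S, Matrix.submatrix_apply, hM, Matrix.of_apply]
            exact hf.1 _
          have hSr : S.rank = 1 := by
            have := Matrix.rank_of_isUnit S ((Matrix.isUnit_iff_isUnit_det S).mpr (isUnit_iff_ne_zero.mpr hS))
            simpa using this
          calc 1 = S.rank := hSr.symm
            _ ≤ M.rank := Matrix.rank_submatrix_le M _ _
    · -- `P ≥ 2`: the leading `r × r` minor with reversed columns is a gap-Monge minor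
      let S : Matrix (Fin r) (Fin r) ℝ :=
        M.submatrix (Fin.castLE hrP) (fun j => Fin.castLE hrH (Fin.rev j))
      have hSeq : S = Matrix.of fun x i : Fin r => f ((fun n => n) x + (fun n => P * (r - 1 - n)) i) := by
        ext x i
        simp only [S, Matrix.submatrix_apply, hM, Matrix.of_apply, Fin.val_castLE, Fin.val_rev]
        congr 1
        rw [show r - (i + 1) = r - 1 - i by omega]; ring
      have hS : S.det ≠ 0 := by
        rw [hSeq]
        exact det_logConcaveMinor_ne_zero hq hf.1 hf.2 (fun n => n) (fun n => P * (r - 1 - n))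
          (fun j _ => by omega) (fun i hi => by
            show P * (r - 1 - (i + 1)) + 2 ≤ P * (r - 1 - i)
            have : r - 1 - i = (r - 1 - (i + 1)) + 1 := by omega
            rw [this, Nat.mul_add]; omega)
      have hSr : S.rank = r := by
        have := Matrix.rank_of_isUnit S ((Matrix.isUnit_iff_isUnit_det S).mpr (isUnit_iff_ne_zero.mpr hS))
        simpa using this
      calc r = S.rank := hSr.symm
        _ ≤ M.rank := Matrix.rank_submatrix_le M _ _

end LogConcave

end Summit.ValiantsHypothesis.ValiantsHypothesis.Theorems.LacunarySymmetroidMatrixDescartes.ReshapingGeneric
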